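import Summits.KontsevichZagierPeriods.Zeta5Search.Certificates.RecordRayExponent
import Summits.KontsevichZagierPeriods.Zeta5Search.DualSeriesSharpConstant
import Literature.NumberTheory.Irrationality.Hata1992.PrimeWindows
import HarnessLib

/-!
# ζ(5) search — certificates: the GENERIC kernel multiplier of a Brown–Zudilin dual pair (TYPER g16)

HONEST FRAMING: systematic search; no irrationality claim unless certified.  Nothing in this file is a statement about
`ζ(5)`: it is the bookkeeping that turns Brown–Zudilin's normalisation (35) (PROVED in the tree: `coeffU_den_sharp`,
`coeffW_den_sharp`, `coeffV_den_sharp`) into an INTEGER-making multiplier for the wedge forms of ANY admissible dual pair,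
and the exponent step for a rational multiplier.  It is the ray-independent part of typer g15's record-ray files
`Certificates/RecordRayDenominators{,Exponent}` (which stay as they are); the T1-map rays H1 / #5 / #1 of P1 g11
(`RayH1.h1_exponent`, `RayC5.c5_exponent`, `RayC1.c1_exponent_sharp`, each CONDITIONAL on a denominator hypothesis (HD))
instantiate it in their `<NS>KernelBase` files.

OUR work (Summit side; typer seat, generation 16).  For a dual pair `(b, b′)` with the same `b₀` and a scalar `ρ`:
* `SharpAdmissible b` — the hypotheses of (35): `InBox b`, the six pair sums `b_j + b_k ≤ b₀`, `Σ_j b_j ≤ 3b₀ + 1`;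
* `zU b = d·N♯(b)·U(b)`, `zW b = d³·N♯(b)·W(b)`, `zV b = d⁶·N♯(b)·V(b)` (`d = lcm(1..b₀)`, `N♯ = sharpNormaliser`) — integers
  (`zU_int`, `zW_int`, `zV_int`);
* `wedgeNum b b′ = zW(b′)zV(b) − zW(b)zV(b′)`, `qNum b b′ = d⁵(zU(b)zW(b′) − zU(b′)zW(b))` and their integer avatars
  `wedgeNumZ`, `qNumZ` (`Rat.floor`; `wedgeNumZ_cast`, `qNumZ_cast`);
* `baseMult b b′ ρ = d⁹·N♯(b)·N♯(b′)/|ρ|`:  `baseMult·(ρ(W′V − WV′)) = ±wedgeNum`, `baseMult·(ρ(UW′ − U′W)) = ±qNum`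
  (`baseMult_mul_wedge`, `baseMult_mul_qminor`), hence integers (`baseMult_ints`), `0 < baseMult`;
* the WINDOW step: if a natural number `Φ` divides `wedgeNumZ` and `qNumZ` then `baseMult/Φ` still makes both forms integers
  (`div_ints`); with `Φ` an atlas `multiWindowProd` this is fed by per-prime DIVISIBILITY CERTIFICATES
  `(p:ℤ)^k ∣ wedgeNumZ ∧ (p:ℤ)^k ∣ qNumZ` (`atlas_ints`), and the valuation → divisibility bridges
  `pow_dvd_wedgeNumZ_of_val`, `pow_dvd_qNumZ_of_val` turn per-prime VALUATION floors of `U, W, V, N♯, d` into such certificates;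
* `exponent_of_rational_multiplier` — decay `|Q_nξ − P_n| ≤ e^{(ℓ+ε)n}`, growth `e^{(c_l−ε)n} ≤ |Q_n| ≤ e^{(c_u+ε)n}` and a
  rational multiplier `0 < M_n ≤ e^{(λ+ε)n}` with `M_nP_n, M_nQ_n ∈ ℤ` give, for every `γ ≥ 0` with `γ(λ + c_u) < c_l − ℓ`,
  eventually INTEGERS `p_n = M_nP_n`, `q_n = M_n|Q_n| ≥ 1` with `|ξ − P_n/Q_n| < 1/q_n^γ`.
-/

noncomputable section

open Finset Real Filter Topology

namespace Summit.KontsevichZagierPeriods.Zeta5Search.RayKernel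

open Summit.KontsevichZagierPeriods.Zeta5Search.DualSeries
open Summit.KontsevichZagierPeriods.Zeta5Search.DualSeriesDenominators
open Summit.KontsevichZagierPeriods.Zeta5Search.WedgeDictionary
open Summit.KontsevichZagierPeriods.Zeta5Search.RecordRay (abs_sub_div_lt_of_bounds)
open Literature.NumberTheory.Irrationality.Hata1992

/-! ### Admissibility and the integer-valued numerators -/

/-- The hypotheses of Brown–Zudilin's normalisation (35) as proved in the tree: the box `0 ≤ b_j ≤ b₀ + 1`, the six pair
conditions `b_j + b_k ≤ b₀` over the pairs `16, 17, 27, 46, 45, 35`, and `Σ_j b_j ≤ 3b₀ + 1`. -/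
def SharpAdmissible (b : ℕ → ℤ) : Prop :=
  InBox b ∧ (∀ s, s < 6 → bn b (pfst s) + bn b (psnd s) ≤ bn b 0) ∧ ∑ j ∈ range 7, b (j + 1) ≤ 3 * b 0 + 1

/-- `d = lcm(1, …, b₀)` as a rational number. -/
def dOf0 (b : ℕ → ℤ) : ℚ := ((Nat.lcmUpto (bn b 0) : ℕ) : ℚ)

/-- `zU b = d·N♯(b)·U(b)`. -/
def zU (b : ℕ → ℤ) : ℚ := dOf0 b * sharpNormaliser b * coeffU b

/-- `zW b = d³·N♯(b)·W(b)`. -/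
def zW (b : ℕ → ℤ) : ℚ := dOf0 b ^ 3 * sharpNormaliser b * coeffW b

/-- `zV b = d⁶·N♯(b)·V(b)`. -/
def zV (b : ℕ → ℤ) : ℚ := dOf0 b ^ 6 * sharpNormaliser b * coeffV b

/-- The multiplied wedge `zW(b′)·zV(b) − zW(b)·zV(b′) = d⁹N♯(b)N♯(b′)·(W′V − WV′)`. -/
def wedgeNum (b b' : ℕ → ℤ) : ℚ := zW b' * zV b - zW b * zV b'

/-- The multiplied Q-minor `d⁵·(zU(b)·zW(b′) − zU(b′)·zW(b)) = d⁹N♯(b)N♯(b′)·(UW′ − U′W)`. -/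
def qNum (b b' : ℕ → ℤ) : ℚ := dOf0 b ^ 5 * (zU b * zW b' - zU b' * zW b)

/-- The integer avatar of `wedgeNum` (its floor; equal to it under admissibility). -/
def wedgeNumZ (b b' : ℕ → ℤ) : ℤ := ⌊wedgeNum b b'⌋

/-- The integer avatar of `qNum`. -/
def qNumZ (b b' : ℕ → ℤ) : ℤ := ⌊qNum b b'⌋

/-- **The baseline multiplier** `baseMult b b′ ρ = d⁹ · N♯(b) · N♯(b′) / |ρ|`. -/
def baseMult (b b' : ℕ → ℤ) (ρ : ℚ) : ℚ := dOf0 b ^ 9 * sharpNormaliser b * sharpNormaliser b' / |ρ|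

variable {b b' : ℕ → ℤ}

/-- `0 < d`. -/
theorem dOf0_pos (b : ℕ → ℤ) : 0 < dOf0 b := by
  unfold dOf0; exact_mod_cast Nat.lcmUpto_pos _

/-- `N♯(b) > 0` (a ratio of factorials; private copy of `RecordRay.sharpNormaliser_pos`, to keep this file free of the
record ray's analytic imports). -/
private theorem sharpNormaliser_pos (b : ℕ → ℤ) : 0 < sharpNormaliser b := by
  unfold sharpNormaliser normaliser
  apply div_pos
  · exact_mod_cast prod_pos fun s _ => Nat.factorial_pos _
  · exact_mod_cast mul_pos (Nat.factorial_pos _) (Nat.factorial_pos _)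

/-- `zU b ∈ ℤ` under admissibility (`coeffU_den_sharp`). -/
theorem zU_int (hb : SharpAdmissible b) : ∃ z : ℤ, zU b = z :=
  coeffU_den_sharp hb.1 hb.2.1 hb.2.2

/-- `zW b ∈ ℤ` under admissibility (`coeffW_den_sharp`). -/
theorem zW_int (hb : SharpAdmissible b) : ∃ z : ℤ, zW b = z :=
  coeffW_den_sharp hb.1 hb.2.1 hb.2.2

/-- `zV b ∈ ℤ` under admissibility (`coeffV_den_sharp`). -/
theorem zV_int (hb : SharpAdmissible b) : ∃ z : ℤ, zV b = z :=
  coeffV_den_sharp hb.1 hb.2.1 hb.2.2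

/-- A rational equal to an integer is its own floor. -/
theorem floor_cast_of_int {x : ℚ} (h : ∃ z : ℤ, x = z) : ((⌊x⌋ : ℤ) : ℚ) = x := by
  obtain ⟨z, rfl⟩ := h
  rw [Int.floor_intCast]

/-- `wedgeNum b b′ ∈ ℤ` (both members admissible). -/
theorem wedgeNum_int (hb : SharpAdmissible b) (hb' : SharpAdmissible b') : ∃ z : ℤ, wedgeNum b b' = z := by
  obtain ⟨w, hw⟩ := zW_int hb
  obtain ⟨v, hv⟩ := zV_int hb
  obtain ⟨w', hw'⟩ := zW_int hb'
  obtain ⟨v', hv'⟩ := zV_int hb'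
  exact ⟨w' * v - w * v', by unfold wedgeNum; rw [hw, hv, hw', hv']; push_cast; ring⟩

/-- `qNum b b′ ∈ ℤ` (both members admissible). -/
theorem qNum_int (hb : SharpAdmissible b) (hb' : SharpAdmissible b') : ∃ z : ℤ, qNum b b' = z := by
  obtain ⟨u, hu⟩ := zU_int hb
  obtain ⟨w, hw⟩ := zW_int hb
  obtain ⟨u', hu'⟩ := zU_int hb'
  obtain ⟨w', hw'⟩ := zW_int hb'
  refine ⟨(Nat.lcmUpto (bn b 0) : ℤ) ^ 5 * (u * w' - u' * w), ?_⟩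
  unfold qNum dOf0; rw [hu, hw, hu', hw']; push_cast; ring

/-- `(wedgeNumZ : ℚ) = wedgeNum`. -/
theorem wedgeNumZ_cast (hb : SharpAdmissible b) (hb' : SharpAdmissible b') :
    ((wedgeNumZ b b' : ℤ) : ℚ) = wedgeNum b b' :=
  floor_cast_of_int (wedgeNum_int hb hb')

/-- `(qNumZ : ℚ) = qNum`. -/
theorem qNumZ_cast (hb : SharpAdmissible b) (hb' : SharpAdmissible b') :
    ((qNumZ b b' : ℤ) : ℚ) = qNum b b' :=
  floor_cast_of_int (qNum_int hb hb')

/-! ### The baseline multiplier -/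

/-- `0 < baseMult b b′ ρ` for `ρ ≠ 0`. -/
theorem baseMult_pos {ρ : ℚ} (hρ : ρ ≠ 0) : 0 < baseMult b b' ρ := by
  unfold baseMult
  exact div_pos (mul_pos (mul_pos (pow_pos (dOf0_pos b) 9) (sharpNormaliser_pos _)) (sharpNormaliser_pos _))
    (abs_pos.2 hρ)

/-- `ρ/|ρ|` is `±1`: for `ρ ≠ 0` there is an integer `s ∈ {1, −1}` with `ρ/|ρ| = s` and `s·s = 1`. -/
theorem sign_div_abs {ρ : ℚ} (hρ : ρ ≠ 0) : ∃ s : ℤ, (s = 1 ∨ s = -1) ∧ ρ / |ρ| = s := by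
  rcases lt_or_gt_of_ne hρ with h | h
  · refine ⟨-1, Or.inr rfl, ?_⟩
    rw [abs_of_neg h]; push_cast; field_simp
  · refine ⟨1, Or.inl rfl, ?_⟩
    rw [abs_of_pos h]; push_cast; field_simp

/-- **`baseMult · ρ(W′V − WV′) = (ρ/|ρ|) · wedgeNum`** (pure algebra; the partner has the same `b₀`). -/
theorem baseMult_mul_wedge (h0 : bn b' 0 = bn b 0) (ρ : ℚ) :
    baseMult b b' ρ * (ρ * (coeffW b' * coeffV b - coeffW b * coeffV b')) = ρ / |ρ| * wedgeNum b b' := by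
  have hd : dOf0 b' = dOf0 b := by unfold dOf0; rw [h0]
  unfold baseMult wedgeNum zW zV
  rw [hd]
  ring

/-- **`baseMult · ρ(UW′ − U′W) = (ρ/|ρ|) · qNum`**. -/
theorem baseMult_mul_qminor (h0 : bn b' 0 = bn b 0) (ρ : ℚ) :
    baseMult b b' ρ * (ρ * (coeffU b * coeffW b' - coeffU b' * coeffW b)) = ρ / |ρ| * qNum b b' := by
  have hd : dOf0 b' = dOf0 b := by unfold dOf0; rw [h0]
  unfold baseMult qNum zU zW
  rw [hd]
  ring

/-- **The window step.**  If a positive natural number `Φ` divides the integers `wedgeNumZ` and `qNumZ`, then the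
multiplier `baseMult/Φ` makes both wedge forms integers (and is positive). -/
theorem div_ints (hb : SharpAdmissible b) (hb' : SharpAdmissible b') (h0 : bn b' 0 = bn b 0) {ρ : ℚ} (hρ : ρ ≠ 0)
    {Φ : ℕ} (hΦ : 0 < Φ) (hdw : (Φ : ℤ) ∣ wedgeNumZ b b') (hdq : (Φ : ℤ) ∣ qNumZ b b') :
    0 < baseMult b b' ρ / Φ ∧
    (∃ z : ℤ, baseMult b b' ρ / Φ * (ρ * (coeffW b' * coeffV b - coeffW b * coeffV b')) = z) ∧
    (∃ z : ℤ, baseMult b b' ρ / Φ * (ρ * (coeffU b * coeffW b' - coeffU b' * coeffW b)) = z) := by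
  obtain ⟨s, -, hs⟩ := sign_div_abs hρ
  have hΦq : (Φ : ℚ) ≠ 0 := by exact_mod_cast hΦ.ne'
  refine ⟨div_pos (baseMult_pos hρ) (by exact_mod_cast hΦ), ?_, ?_⟩
  · obtain ⟨q, hq⟩ := hdw
    refine ⟨s * q, ?_⟩
    have e : wedgeNum b b' = (Φ : ℚ) * q := by rw [← wedgeNumZ_cast hb hb', hq]; push_cast; ring
    calc baseMult b b' ρ / Φ * (ρ * (coeffW b' * coeffV b - coeffW b * coeffV b'))
        = baseMult b b' ρ * (ρ * (coeffW b' * coeffV b - coeffW b * coeffV b')) / Φ := by ring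
      _ = s * ((Φ : ℚ) * q) / Φ := by rw [baseMult_mul_wedge h0, hs, e]
      _ = ((s * q : ℤ) : ℚ) := by push_cast; field_simp
  · obtain ⟨q, hq⟩ := hdq
    refine ⟨s * q, ?_⟩
    have e : qNum b b' = (Φ : ℚ) * q := by rw [← qNumZ_cast hb hb', hq]; push_cast; ring
    calc baseMult b b' ρ / Φ * (ρ * (coeffU b * coeffW b' - coeffU b' * coeffW b))
        = baseMult b b' ρ * (ρ * (coeffU b * coeffW b' - coeffU b' * coeffW b)) / Φ := by ring
      _ = s * ((Φ : ℚ) * q) / Φ := by rw [baseMult_mul_qminor h0, hs, e]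
      _ = ((s * q : ℤ) : ℚ) := by push_cast; field_simp

/-- The baseline itself (`Φ = 1`): `baseMult·ρ(W′V − WV′) ∈ ℤ`, `baseMult·ρ(UW′ − U′W) ∈ ℤ`. -/
theorem baseMult_ints (hb : SharpAdmissible b) (hb' : SharpAdmissible b') (h0 : bn b' 0 = bn b 0) {ρ : ℚ}
    (hρ : ρ ≠ 0) :
    (∃ z : ℤ, baseMult b b' ρ * (ρ * (coeffW b' * coeffV b - coeffW b * coeffV b')) = z) ∧
    (∃ z : ℤ, baseMult b b' ρ * (ρ * (coeffU b * coeffW b' - coeffU b' * coeffW b)) = z) := by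
  obtain ⟨-, h1, h2⟩ := div_ints hb hb' h0 hρ (Φ := 1) Nat.one_pos (by simp) (by simp)
  simp only [Nat.cast_one, div_one] at h1 h2
  exact ⟨h1, h2⟩

/-- **The atlas step.**  A finite atlas of prime windows `(A_i n, B_i n]` with weights `w_i`, pairwise disjoint at `n`, each of
whose primes carries a divisibility certificate `p^{w_i} ∣ wedgeNumZ ∧ p^{w_i} ∣ qNumZ`, divides out of the baseline:
`baseMult/Φ_n` (`Φ_n = multiWindowProd s A B w n`) makes both wedge forms integers. -/
theorem atlas_ints {ι : Type*} [DecidableEq ι] (s : Finset ι) (A B : ι → ℝ) (w : ι → ℕ) (n : ℕ)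
    (hb : SharpAdmissible b) (hb' : SharpAdmissible b') (h0 : bn b' 0 = bn b 0) {ρ : ℚ} (hρ : ρ ≠ 0)
    (hcert : ∀ i ∈ s, ∀ p ∈ windowPrimes (A i) (B i) n,
      (p : ℤ) ^ w i ∣ wedgeNumZ b b' ∧ (p : ℤ) ^ w i ∣ qNumZ b b')
    (hdisj : ∀ i ∈ s, ∀ j ∈ s, i ≠ j → Disjoint (windowPrimes (A i) (B i) n) (windowPrimes (A j) (B j) n)) :
    0 < baseMult b b' ρ / (multiWindowProd s A B w n : ℕ) ∧
    (∃ z : ℤ, baseMult b b' ρ / (multiWindowProd s A B w n : ℕ) *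
      (ρ * (coeffW b' * coeffV b - coeffW b * coeffV b')) = z) ∧
    (∃ z : ℤ, baseMult b b' ρ / (multiWindowProd s A B w n : ℕ) *
      (ρ * (coeffU b * coeffW b' - coeffU b' * coeffW b)) = z) :=
  div_ints hb hb' h0 hρ (multiWindowProd_pos s A B w n)
    (multiWindowProd_dvd_int (fun i hi p hp => (hcert i hi p hp).1) hdisj)
    (multiWindowProd_dvd_int (fun i hi p hp => (hcert i hi p hp).2) hdisj)

/-! ### From per-prime valuations to divisibility certificates -/

section Valuations

variable {p : ℕ} [hp : Fact p.Prime]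

/-- An integer-valued rational `x = z` with `k ≤ v_p(x)` (or `x = 0`) has `p^k ∣ z`. -/
theorem pow_dvd_of_le_padicValRat {x : ℚ} {z : ℤ} (hx : x = z) {k : ℕ}
    (hk : x ≠ 0 → (k : ℤ) ≤ padicValRat p x) : (p : ℤ) ^ k ∣ z := by
  by_cases hz : z = 0
  · rw [hz]; exact dvd_zero _
  have hx0 : x ≠ 0 := by rw [hx]; exact_mod_cast hz
  rw [padicValInt_dvd_iff]
  right
  have h := hk hx0
  rw [hx, padicValRat.of_int] at h
  exact_mod_cast h

/-- `v_p(zW b) = 3·v_p(d) + v_p(N♯ b) + v_p(W b)` when `W b ≠ 0`. -/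
theorem padicValRat_zW (hW : coeffW b ≠ 0) :
    padicValRat p (zW b) = 3 * padicValRat p (dOf0 b) + padicValRat p (sharpNormaliser b) + padicValRat p (coeffW b) := by
  have hd : dOf0 b ≠ 0 := (dOf0_pos b).ne'
  have hN : sharpNormaliser b ≠ 0 := (sharpNormaliser_pos b).ne'
  unfold zW
  rw [padicValRat.mul (mul_ne_zero (pow_ne_zero _ hd) hN) hW, padicValRat.mul (pow_ne_zero _ hd) hN, padicValRat.pow]
  push_cast; ring

/-- `v_p(zV b) = 6·v_p(d) + v_p(N♯ b) + v_p(V b)` when `V b ≠ 0`. -/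
theorem padicValRat_zV (hV : coeffV b ≠ 0) :
    padicValRat p (zV b) = 6 * padicValRat p (dOf0 b) + padicValRat p (sharpNormaliser b) + padicValRat p (coeffV b) := by
  have hd : dOf0 b ≠ 0 := (dOf0_pos b).ne'
  have hN : sharpNormaliser b ≠ 0 := (sharpNormaliser_pos b).ne'
  unfold zV
  rw [padicValRat.mul (mul_ne_zero (pow_ne_zero _ hd) hN) hV, padicValRat.mul (pow_ne_zero _ hd) hN, padicValRat.pow]
  push_cast; ring

/-- `v_p(zU b) = v_p(d) + v_p(N♯ b) + v_p(U b)` when `U b ≠ 0`. -/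
theorem padicValRat_zU (hU : coeffU b ≠ 0) :
    padicValRat p (zU b) = padicValRat p (dOf0 b) + padicValRat p (sharpNormaliser b) + padicValRat p (coeffU b) := by
  have hd : dOf0 b ≠ 0 := (dOf0_pos b).ne'
  have hN : sharpNormaliser b ≠ 0 := (sharpNormaliser_pos b).ne'
  unfold zU
  rw [padicValRat.mul (mul_ne_zero hd hN) hU, padicValRat.mul hd hN]

/-- One wedge product: if `k ≤ v_p(zW b₁) + v_p(zV b₂)` whenever `W(b₁)V(b₂) ≠ 0`, then `p^k` divides the integer
`zW(b₁)·zV(b₂)`. -/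
theorem pow_dvd_zW_mul_zV {b₁ b₂ : ℕ → ℤ} {k : ℕ}
    (hk : coeffW b₁ ≠ 0 → coeffV b₂ ≠ 0 → (k : ℤ) ≤ padicValRat p (zW b₁) + padicValRat p (zV b₂))
    {w v : ℤ} (hw : zW b₁ = w) (hv : zV b₂ = v) : (p : ℤ) ^ k ∣ w * v := by
  refine pow_dvd_of_le_padicValRat (x := zW b₁ * zV b₂) (by rw [hw, hv]; push_cast; ring) fun hx => ?_
  have hW : coeffW b₁ ≠ 0 := by intro h; apply hx; unfold zW; rw [h]; ring
  have hV : coeffV b₂ ≠ 0 := by intro h; apply hx; unfold zV; rw [h]; ring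
  rw [padicValRat.mul (left_ne_zero_of_mul hx) (right_ne_zero_of_mul hx)]
  exact hk hW hV

/-- One Q-side product: if `k ≤ 5·v_p(d) + v_p(zU b₁) + v_p(zW b₂)` whenever `U(b₁)W(b₂) ≠ 0` (`d = d_{b₀}` of `b`), then
`p^k` divides the integer `d⁵·zU(b₁)·zW(b₂)`. -/
theorem pow_dvd_d5_zU_mul_zW {b₁ b₂ : ℕ → ℤ} {k : ℕ}
    (hk : coeffU b₁ ≠ 0 → coeffW b₂ ≠ 0 →
      (k : ℤ) ≤ 5 * padicValRat p (dOf0 b) + padicValRat p (zU b₁) + padicValRat p (zW b₂))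
    {u w : ℤ} (hu : zU b₁ = u) (hw : zW b₂ = w) :
    (p : ℤ) ^ k ∣ (Nat.lcmUpto (bn b 0) : ℤ) ^ 5 * (u * w) := by
  have hd : dOf0 b ≠ 0 := (dOf0_pos b).ne'
  refine pow_dvd_of_le_padicValRat (x := dOf0 b ^ 5 * (zU b₁ * zW b₂))
    (by unfold dOf0; rw [hu, hw]; push_cast; ring) fun hx => ?_
  have hx' : zU b₁ * zW b₂ ≠ 0 := right_ne_zero_of_mul hx
  have hU : coeffU b₁ ≠ 0 := by intro h; apply hx'; unfold zU; rw [h]; ring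
  have hW : coeffW b₂ ≠ 0 := by intro h; apply hx'; unfold zW; rw [h]; ring
  rw [padicValRat.mul (pow_ne_zero _ hd) hx', padicValRat.pow,
    padicValRat.mul (left_ne_zero_of_mul hx') (right_ne_zero_of_mul hx')]
  have := hk hU hW
  push_cast; linarith

/-- **Valuation → certificate, wedge side.**  If for BOTH orderings `(b₁, b₂) ∈ {(b′, b), (b, b′)}` one has
`k ≤ v_p(zW b₁) + v_p(zV b₂)` whenever `W(b₁)V(b₂) ≠ 0`, then `p^k ∣ wedgeNumZ b b′`. -/
theorem pow_dvd_wedgeNumZ_of_val (hb : SharpAdmissible b) (hb' : SharpAdmissible b') {k : ℕ}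
    (h1 : coeffW b' ≠ 0 → coeffV b ≠ 0 → (k : ℤ) ≤ padicValRat p (zW b') + padicValRat p (zV b))
    (h2 : coeffW b ≠ 0 → coeffV b' ≠ 0 → (k : ℤ) ≤ padicValRat p (zW b) + padicValRat p (zV b')) :
    (p : ℤ) ^ k ∣ wedgeNumZ b b' := by
  obtain ⟨w, hw⟩ := zW_int hb
  obtain ⟨v, hv⟩ := zV_int hb
  obtain ⟨w', hw'⟩ := zW_int hb'
  obtain ⟨v', hv'⟩ := zV_int hb'
  have hZ : wedgeNumZ b b' = w' * v - w * v' := by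
    have : ((wedgeNumZ b b' : ℤ) : ℚ) = ((w' * v - w * v' : ℤ) : ℚ) := by
      rw [wedgeNumZ_cast hb hb']; unfold wedgeNum; rw [hw, hv, hw', hv']; push_cast; ring
    exact_mod_cast this
  rw [hZ]
  exact dvd_sub (pow_dvd_zW_mul_zV h1 hw' hv) (pow_dvd_zW_mul_zV h2 hw hv')

/-- **Valuation → certificate, Q side.**  If for both orderings `(b₁, b₂) ∈ {(b, b′), (b′, b)}` one has
`k ≤ 5·v_p(d) + v_p(zU b₁) + v_p(zW b₂)` whenever `U(b₁)W(b₂) ≠ 0`, then `p^k ∣ qNumZ b b′`. -/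
theorem pow_dvd_qNumZ_of_val (hb : SharpAdmissible b) (hb' : SharpAdmissible b') {k : ℕ}
    (h1 : coeffU b ≠ 0 → coeffW b' ≠ 0 →
      (k : ℤ) ≤ 5 * padicValRat p (dOf0 b) + padicValRat p (zU b) + padicValRat p (zW b'))
    (h2 : coeffU b' ≠ 0 → coeffW b ≠ 0 →
      (k : ℤ) ≤ 5 * padicValRat p (dOf0 b) + padicValRat p (zU b') + padicValRat p (zW b)) :
    (p : ℤ) ^ k ∣ qNumZ b b' := by
  obtain ⟨u, hu⟩ := zU_int hb
  obtain ⟨w, hw⟩ := zW_int hb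
  obtain ⟨u', hu'⟩ := zU_int hb'
  obtain ⟨w', hw'⟩ := zW_int hb'
  have hZ : qNumZ b b' = (Nat.lcmUpto (bn b 0) : ℤ) ^ 5 * (u * w') - (Nat.lcmUpto (bn b 0) : ℤ) ^ 5 * (u' * w) := by
    have : ((qNumZ b b' : ℤ) : ℚ) =
        (((Nat.lcmUpto (bn b 0) : ℤ) ^ 5 * (u * w') - (Nat.lcmUpto (bn b 0) : ℤ) ^ 5 * (u' * w) : ℤ) : ℚ) := by
      rw [qNumZ_cast hb hb']; unfold qNum dOf0; rw [hu, hw, hu', hw']; push_cast; ring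
    exact_mod_cast this
  rw [hZ]
  refine dvd_sub (pow_dvd_d5_zU_mul_zW (b := b) h1 hu hw') ?_
  have h2' : coeffU b' ≠ 0 → coeffW b ≠ 0 →
      (k : ℤ) ≤ 5 * padicValRat p (dOf0 b) + padicValRat p (zU b') + padicValRat p (zW b) := h2
  exact pow_dvd_d5_zU_mul_zW (b := b) h2' hu' hw

end Valuations

/-! ### The exponent step for a rational multiplier -/

/-- **Effective exponent from a RATIONAL multiplier (generic).**  Let `ξ ∈ ℝ`, `P_n ∈ ℚ`, `Q_n ∈ ℤ`.  Suppose, for every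
`ε > 0`, eventually `|Q_nξ − P_n| ≤ e^{(ℓ+ε)n}`, `e^{(c_l−ε)n} ≤ |Q_n| ≤ e^{(c_u+ε)n}`, and `0 < M_n`, `M_nP_n ∈ ℤ`,
`M_nQ_n ∈ ℤ`, `M_n ≤ e^{(λ+ε)n}` for a rational multiplier `M_n`.  Then for every `γ ≥ 0` with `γ·(λ + c_u) < c_l − ℓ`,
eventually there are INTEGERS `p_n = M_nP_n`, `q_n = M_n|Q_n| ≥ 1` with `|ξ − P_n/Q_n| < 1/q_n^γ`
(`RecordRayExponent.abs_sub_div_lt_of_bounds`).  No irrationality content by itself (`γ < 1` in every use of the cell). -/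
theorem exponent_of_rational_multiplier {ξ : ℝ} {P : ℕ → ℚ} {Q : ℕ → ℤ} {ℓ cl cu lam γ : ℝ} (M : ℕ → ℚ)
    (hform : ∀ ε : ℝ, 0 < ε → ∀ᶠ n : ℕ in atTop, |(Q n : ℝ) * ξ - (P n : ℝ)| ≤ Real.exp ((ℓ + ε) * n))
    (hQl : ∀ ε : ℝ, 0 < ε → ∀ᶠ n : ℕ in atTop, Real.exp ((cl - ε) * n) ≤ |(Q n : ℝ)|)
    (hQu : ∀ ε : ℝ, 0 < ε → ∀ᶠ n : ℕ in atTop, |(Q n : ℝ)| ≤ Real.exp ((cu + ε) * n))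
    (hM : ∀ ε : ℝ, 0 < ε → ∀ᶠ n : ℕ in atTop, 0 < M n ∧ (∃ z : ℤ, M n * P n = z) ∧ (∃ z : ℤ, M n * Q n = z) ∧
      ((M n : ℚ) : ℝ) ≤ Real.exp ((lam + ε) * n))
    (hγ : 0 ≤ γ) (hrate : γ * (lam + cu) < cl - ℓ) :
    ∀ᶠ n : ℕ in atTop, ∃ p : ℤ, ∃ q : ℕ, 1 ≤ q ∧ (q : ℚ) = M n * |(Q n : ℚ)| ∧ (p : ℚ) = M n * P n ∧
      |ξ - (P n : ℝ) / (Q n : ℝ)| < 1 / (q : ℝ) ^ γ := by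
  -- room ε
  set ε : ℝ := (cl - ℓ - γ * (lam + cu)) / (2 * (γ + 2)) with hε
  have hεpos : 0 < ε := by rw [hε]; exact div_pos (by linarith) (by positivity)
  have hrate' : γ * ((lam + ε) + (cu + ε)) < (cl - ε) - (ℓ + ε) := by
    have hg2 : 0 < γ + 2 := by linarith
    have hmul : ε * (2 * (γ + 2)) = cl - ℓ - γ * (lam + cu) := by rw [hε]; field_simp
    nlinarith
  have hD' : ∀ᶠ n : ℕ in atTop, 0 < ((M n : ℚ) : ℝ) ∧ ((M n : ℚ) : ℝ) ≤ Real.exp ((lam + ε) * n) := by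
    filter_upwards [hM ε hεpos] with n hn; exact ⟨by exact_mod_cast hn.1, hn.2.2.2⟩
  have key := abs_sub_div_lt_of_bounds (ξ := ξ) (Q := fun n => (Q n : ℝ)) (P := fun n => (P n : ℝ))
    (D := fun n => ((M n : ℚ) : ℝ)) (hform ε hεpos) (hQl ε hεpos) (hQu ε hεpos) hD' hγ hrate'
  filter_upwards [key, hM ε hεpos, hQl ε hεpos] with n hn hMn hQln
  obtain ⟨hMpos, ⟨zP, hzP⟩, ⟨zQ, hzQ⟩, -⟩ := hMn
  have hQ : Q n ≠ 0 := by
    intro h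
    have := (Real.exp_pos ((cl - ε) * n)).trans_le hQln
    rw [h] at this; simp at this
  refine ⟨zP, zQ.natAbs, ?_, ?_, hzP.symm, ?_⟩
  · have : zQ ≠ 0 := by
      intro h0
      rw [h0] at hzQ
      push_cast at hzQ
      rcases mul_eq_zero.1 hzQ with h1 | h1
      · exact absurd h1 hMpos.ne'
      · exact hQ (by exact_mod_cast h1)
    exact Nat.one_le_iff_ne_zero.mpr (Int.natAbs_ne_zero.mpr this)
  · rw [Nat.cast_natAbs, Int.cast_abs, ← hzQ, abs_mul, abs_of_pos hMpos]
  · have hcast : ((zQ.natAbs : ℕ) : ℝ) = ((M n : ℚ) : ℝ) * |(Q n : ℝ)| := by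
      rw [Nat.cast_natAbs, Int.cast_abs]
      have : ((zQ : ℤ) : ℝ) = ((M n * Q n : ℚ) : ℝ) := by rw [hzQ]; norm_cast
      rw [this]; push_cast
      rw [abs_mul, abs_of_pos (by exact_mod_cast hMpos : (0 : ℝ) < ((M n : ℚ) : ℝ))]
    rw [hcast]
    exact hn

end Summit.KontsevichZagierPeriods.Zeta5Search.RayKernel
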